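import Literature.AlgebraicGeometry.HodgeTheory.SupportedClassesRationalProofs
import Literature.AlgebraicGeometry.HodgeTheory.BettiUniverseAxioms
import HarnessLib

/-!
# Pull-backs bijective on `Hᵏ(−; ℚ)` are bijective on `Hᵏ(−; ℂ)` (universal coefficients `ℚ → ℂ`)

Layer `Literature/AlgebraicGeometry/HodgeTheory`.  A. Hatcher, *Algebraic Topology* (2002), §3.1 Thm. 3.2 and
p. 198 (change of coefficients); C. Voisin, *Hodge Theory I*, §7.1.1 («`Hᵏ(X, ℚ) ⊗ ℂ = Hᵏ(X, ℂ)`»).  For a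
`ℂ`-morphism `f : X ⟶ Y` of `ℂ`-schemes whose complex points have finite-dimensional rational homology in degree `k`:

* `ofRatClassBaseChange_bijective` — the complexification `Θ : ℂ ⊗_ℚ Hᵏ(Z; ℚ) → Hᵏ(Z; ℂ)` (tree
  `Motives.ofRatClassBaseChange`) is a BIJECTION as soon as `Hₖ(Z; ℚ)` is finite-dimensional (injective for every
  space, `ofRatClassBaseChange_injective`; onto because the rational classes span, `span_isRationalClass_eq_top`);
* `complexBetti_map_ofRatClassBaseChange` — naturality `f^*_ℂ ∘ Θ_Y = Θ_X ∘ (1 ⊗ f^*_ℚ)` (`ofRatClass_map`);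
* **`bijective_complexBetti_map_of_bijective_pull`** — if `f^* : Hᵏ(Y(ℂ); ℚ) → Hᵏ(X(ℂ); ℚ)`
  (`BettiUniverse.pull f k`) is bijective then so is `f^* : Hᵏ(Y(ℂ); ℂ) → Hᵏ(X(ℂ); ℂ)` (`complexBetti.map f k`);
* `ofRatClassBaseChangeEquivOfFinite` — the same as a `LinearEquiv` `ℂ ⊗_ℚ Hᵏ(Z; ℚ) ≃ₗ[ℂ] Hᵏ(Z; ℂ)` (finite `Hₖ(Z; ℚ)`), with its naturality
  `complexBetti_map_ofRatClassBaseChangeEquivOfFinite` — «`complexBetti X k = ℂ ⊗_ℚ bettiCohomology X k`, naturally»;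
* `finite_singularHomology_rat_complexPoints_of_proper` — `Hₖ(X(ℂ); ℚ)` is finite-dimensional for `X` proper and smooth
  of relative dimension `n` over `ℂ` (NOT necessarily irreducible: the tree's `finite_singularHomology_rat_complexPoints`
  for `IsSmoothProjective`, same chart proof — `X(ℂ)` is a compact Hausdorff topological `2n`-manifold, Hatcher App. A
  Cor. A.8–A.9).

Written for the cell `hodgecm-mathlib` (D-0151), row III-0 (the `ℚ → ℂ` coefficient change between the named fact
`Liu2021.albanese_bettiOne_pullback_bijective` and `AppendixC.AlbaneseH1ComparisonFamily`).  Everything is proved; no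
definition, no named fact, no instance.

## References

* [HatcherAT2002] A. Hatcher, *Algebraic Topology*, CUP 2002, §3.1 Thm. 3.2 and p. 198; App. A Cor. A.8–A.9.
* [VoisinHodgeI2002] C. Voisin, *Hodge Theory and Complex Algebraic Geometry I* (2002), §7.1.1.
* [SerreGAGA1956] J.-P. Serre, GAGA, Ann. Inst. Fourier 6 (1956), §2 (the analytic topology on `X(ℂ)`).
-/

noncomputable section

open CategoryTheory Function
open scoped TensorProduct
open Literature.AlgebraicTopology.SingularHomology
open Literature.AlgebraicGeometry.Motives (ofRatClassBaseChange ofRatClassBaseChange_tmul ofRatClass_map ComplexPoints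
  bettiCohomology)

namespace Literature.AlgebraicGeometry.HodgeTheory

universe u

/-! ### The complexification is a bijection when rational homology is finite-dimensional -/

/-- **`ℂ ⊗_ℚ Hᵏ(Z; ℚ) → Hᵏ(Z; ℂ)` is a bijection** for every space `Z` with `Hₖ(Z; ℚ)` finite-dimensional
(injective always; onto since the rational classes span). [cite: HatcherAT2002, §3.1 Thm. 3.2 and p. 198]
[cite: VoisinHodgeI2002, §7.1.1] -/
theorem ofRatClassBaseChange_bijective (Z : Type u) [TopologicalSpace Z] (k : ℕ)
    [Module.Finite ℚ (singularHomology ℚ ℚ Z k)] : Bijective (ofRatClassBaseChange Z k) := by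
  refine ⟨ofRatClassBaseChange_injective Z k, ?_⟩
  rw [← LinearMap.range_eq_top, range_ofRatClassBaseChange, span_isRationalClass_eq_top]

/-! ### Naturality of the complexification and transfer of bijectivity -/

section Transfer

variable {X Y : Motives.SchemeOver ℂ} (f : X ⟶ Y) (k : ℕ)

/-- **Naturality of the complexification**: `f^*_ℂ (Θ_Y t) = Θ_X ((1 ⊗ f^*_ℚ) t)` for `t ∈ ℂ ⊗_ℚ Hᵏ(Y(ℂ); ℚ)`
(`(f^* a) ⊗ 1 = f^* (a ⊗ 1)`, `ofRatClass_map`). [cite: HatcherAT2002, §3.1 p. 198] -/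
theorem complexBetti_map_ofRatClassBaseChange (t : ℂ ⊗[ℚ] bettiCohomology Y k) :
    (complexBetti.map f k).hom (ofRatClassBaseChange (ComplexPoints Y) k t) =
      ofRatClassBaseChange (ComplexPoints X) k ((BettiUniverse.pull f k).baseChange ℂ t) := by
  induction t using TensorProduct.induction_on with
  | zero => simp only [map_zero]
  | tmul c a =>
    rw [LinearMap.baseChange_tmul, ofRatClassBaseChange_tmul, ofRatClassBaseChange_tmul, map_smul, ofRatClass_map]
  | add x y hx hy => rw [map_add, map_add, hx, hy, map_add, map_add]

/-- **If `f^*` is bijective on `Hᵏ(−; ℚ)` it is bijective on `Hᵏ(−; ℂ)`** (for `X(ℂ)`, `Y(ℂ)` with finite-dimensional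
`Hₖ(−; ℚ)`): `f^*_ℂ = Θ_X ∘ (1 ⊗ f^*_ℚ) ∘ Θ_Y⁻¹` with all three factors bijections.
[cite: HatcherAT2002, §3.1 Thm. 3.2 and p. 198] [cite: VoisinHodgeI2002, §7.1.1] -/
theorem bijective_complexBetti_map_of_bijective_pull
    [Module.Finite ℚ (singularHomology ℚ ℚ (ComplexPoints X) k)]
    [Module.Finite ℚ (singularHomology ℚ ℚ (ComplexPoints Y) k)]
    (h : Bijective (BettiUniverse.pull f k)) : Bijective (complexBetti.map f k).hom := by
  -- `1 ⊗ f^*_ℚ` as a linear equivalence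
  let e : ℂ ⊗[ℚ] bettiCohomology Y k ≃ₗ[ℂ] ℂ ⊗[ℚ] bettiCohomology X k :=
    (LinearEquiv.ofBijective (BettiUniverse.pull f k) h).baseChange ℚ ℂ _ _
  have he : ∀ t, e t = (BettiUniverse.pull f k).baseChange ℂ t := fun t ↦ rfl
  have hsq : (complexBetti.map f k).hom ∘ ofRatClassBaseChange (ComplexPoints Y) k =
      ofRatClassBaseChange (ComplexPoints X) k ∘ e :=
    funext fun t ↦ by rw [comp_apply, comp_apply, he, complexBetti_map_ofRatClassBaseChange]
  have hY := ofRatClassBaseChange_bijective (ComplexPoints Y) k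
  have hX := ofRatClassBaseChange_bijective (ComplexPoints X) k
  -- `f^*_ℂ ∘ Θ_Y` is a bijection, and `Θ_Y` is onto
  have hcomp : Bijective ((complexBetti.map f k).hom ∘ ofRatClassBaseChange (ComplexPoints Y) k) := by
    rw [hsq]; exact hX.comp e.bijective
  exact (Bijective.of_comp_iff _ hY).1 hcomp

end Transfer

/-! ### Finiteness of rational homology for proper smooth `ℂ`-schemes (possibly reducible) -/

/-- **`Hₖ(X(ℂ); ℚ)` is finite-dimensional for `X` proper and smooth of relative dimension `n` over `ℂ`** — `X(ℂ)` is a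
compact Hausdorff topological `2n`-manifold (holomorphic algebraic charts, `exists_algebraicChart_holds`; compact since
`X` is proper, Hausdorff since separated), Hatcher App. A Cor. A.8–A.9.  The tree's `finite_singularHomology_rat_complexPoints`
without the irreducibility clause of `IsSmoothProjective`. [cite: HatcherAT2002, App. A Cor. A.8 and A.9 p. 527] [cite: SerreGAGA1956, §2] -/
theorem finite_singularHomology_rat_complexPoints_of_proper {n : ℕ} (X : Motives.SchemeOver ℂ)
    [AlgebraicGeometry.SmoothOfRelativeDimension n X.hom] [AlgebraicGeometry.IsProper X.hom] (k : ℕ) :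
    Module.Finite ℚ (singularHomology ℚ ℚ (Motives.ComplexPoints X) k) := by
  haveI : AlgebraicGeometry.Smooth X.hom := AlgebraicGeometry.SmoothOfRelativeDimension.smooth n X.hom
  choose chart mem _ using fun P : Motives.ComplexPoints X ↦
    Literature.NumberTheory.Transcendental.exists_algebraicChart_holds X n P
  let eC : (Fin n → ℂ) ≃ₜ EuclideanSpace ℝ (Fin (2 * n)) :=
    (ContinuousLinearEquiv.ofFinrankEq (𝕜 := ℝ) (by
      rw [Module.finrank_pi_fintype, finrank_euclideanSpace_fin]
      simp [Complex.finrank_real_complex, mul_comm])).toHomeomorph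
  letI : ChartedSpace (EuclideanSpace ℝ (Fin (2 * n))) (Motives.ComplexPoints X) :=
    { atlas := Set.range fun P ↦ (chart P).transHomeomorph eC
      chartAt := fun P ↦ (chart P).transHomeomorph eC
      mem_chart_source := fun P ↦ by
        rw [OpenPartialHomeomorph.transHomeomorph_source]; exact mem P
      chart_mem_atlas := fun P ↦ ⟨P, rfl⟩ }
  haveI : CompactSpace (Motives.ComplexPoints X) :=
    Motives.compactSpace_algPoints_of_isProper_holds X ℂ
  haveI : T2Space (Motives.ComplexPoints X) := Motives.ComplexPoints.t2Space_of_isSeparated X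
  exact finite_singularHomology_of_compact_chartedSpace ℚ ℚ (d := 2 * n) k

/-! ### The natural isomorphism `ℂ ⊗_ℚ Hᵏ(X(ℂ); ℚ) ≃ Hᵏ(X(ℂ); ℂ)` packaged -/

section Equiv

variable (Z : Type u) [TopologicalSpace Z] (k : ℕ) [Module.Finite ℚ (singularHomology ℚ ℚ Z k)]

/-- **Universal coefficients `ℚ → ℂ` as a linear ISOMORPHISM**: `ℂ ⊗_ℚ Hᵏ(Z; ℚ) ≃ₗ[ℂ] Hᵏ(Z; ℂ)`, `c ⊗ a ↦ c • (a ⊗ 1)`, for every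
space with `Hₖ(Z; ℚ)` finite-dimensional (`ofRatClassBaseChange_bijective`).  For `Z = X(ℂ)`: `ℂ ⊗_ℚ bettiCohomology X k ≃ complexBetti X k`
— the tree's `ofRatClassBaseChangeEquiv hX k` asks `X` smooth projective IRREDUCIBLE; this version only asks finite homology (e.g. `X`
smooth proper reducible, `finite_singularHomology_rat_complexPoints_of_proper`).
[cite: HatcherAT2002, §3.1 Thm. 3.2 and p. 198] [cite: VoisinHodgeI2002, §7.1.1] -/
def ofRatClassBaseChangeEquivOfFinite : ℂ ⊗[ℚ] singularCohomology ℚ ℚ Z k ≃ₗ[ℂ] singularCohomology ℂ ℂ Z k :=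
  LinearEquiv.ofBijective (ofRatClassBaseChange Z k) (ofRatClassBaseChange_bijective Z k)

/-- The isomorphism is `ofRatClassBaseChange` as a function. [cite: HatcherAT2002, §3.1 p. 198] -/
@[simp]
theorem ofRatClassBaseChangeEquivOfFinite_apply (t : ℂ ⊗[ℚ] singularCohomology ℚ ℚ Z k) :
    ofRatClassBaseChangeEquivOfFinite Z k t = ofRatClassBaseChange Z k t := rfl

/-- On pure tensors: `c ⊗ a ↦ c • (a ⊗ 1)`. [cite: HatcherAT2002, §3.1 p. 198] -/
theorem ofRatClassBaseChangeEquivOfFinite_tmul (c : ℂ) (a : singularCohomology ℚ ℚ Z k) :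
    ofRatClassBaseChangeEquivOfFinite Z k (c ⊗ₜ a) = c • ofRatClass Z k a :=
  ofRatClassBaseChange_tmul Z k c a

end Equiv

/-- **Naturality of the isomorphism in `ℂ`-morphisms `f : X ⟶ Y`**: `f^*_ℂ ∘ Θ_Y = Θ_X ∘ (1 ⊗ f^*_ℚ)` — `complexBetti X k` IS
`ℂ ⊗_ℚ bettiCohomology X k`, compatibly with pull-backs. [cite: HatcherAT2002, §3.1 p. 198] -/
theorem complexBetti_map_ofRatClassBaseChangeEquivOfFinite {X Y : Motives.SchemeOver ℂ} (f : X ⟶ Y) (k : ℕ)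
    [Module.Finite ℚ (singularHomology ℚ ℚ (ComplexPoints X) k)] [Module.Finite ℚ (singularHomology ℚ ℚ (ComplexPoints Y) k)]
    (t : ℂ ⊗[ℚ] bettiCohomology Y k) :
    (complexBetti.map f k).hom (ofRatClassBaseChangeEquivOfFinite (ComplexPoints Y) k t) =
      ofRatClassBaseChangeEquivOfFinite (ComplexPoints X) k ((BettiUniverse.pull f k).baseChange ℂ t) :=
  complexBetti_map_ofRatClassBaseChange f k t

end Literature.AlgebraicGeometry.HodgeTheory

end
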